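import Summits.AtomisticToContinuum.BoseEinsteinCondensation.Theorems.BECInfDivCoherenceLevyMassCondensationGrid
import Summits.AtomisticToContinuum.BoseEinsteinCondensation.Theorems.BECInfDivCoherenceLevyMassCondensationTranslation
import HarnessLib

/-!
# Route `BECInfDivCoherence`, crux `GridInfDivCoherence` (stmt-AtomisticToContinuum-9114): the grid average
# of the coherence from three moments of its discrete Lévy weights — no pointwise sign condition

Support file (`--supports stmt-AtomisticToContinuum-9114`; lead c2). Single-state form of the route's glue
with the crux WEAKENED to what is actually consumed: for one periodic trial state `Ψ`, a particle `i` with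
kinetic energy `≤ T`, a grid `m ≥ 2` (`h = L/m`, `h²T ≤ 1`), translation coherence `G > 0` at the nodes and
discrete Lévy weights `ν_q` of `log G`, the three inputs
* the kinetic f-sum `Σ_q ν_q λ_q ≤ h²T` (proved here: `levyWeight_fsum`, `one_sub_coh_le`, `−log x ≤ 2(1−x)`),
* a bound `Σ_{q≠0} ν_q⁻ λ_q ≤ B` on the `λ`-weighted NEGATIVE Lévy mass (`λ_q = Σ_a (1 − cos(2πq_a/m))`) —
  the only way the glue `levyMass_le` uses the crux `GridInfDivCoherence` (there `B = 6εm³`),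
* the `(−1)`-moment `Σ_{q≠0} ν_q⁺/|k_q| ≤ C` of crux `LevyNegativeMoment`,
give `gridAverage_exp_lower_bound`: `m⁻³ Σ_j G(hj) ≥ exp(−(π²(T + B/h²)/(6s²) + 2sC/3))` for every `s > 0`
(Jordan `|k_q|² ≤ (π²/2h²)λ_q`, the splitting `1 ≤ (|k|/s)²/3 + (2/3)(s/|k|)`, `Σ_q ν_q = log G(0) = 0`, AM–GM).
So a restated crux "`Σ_{q≠0} ν̃_q⁻ λ_q ≤ B h²` uniformly" closes the route exactly as the filed one does, and the
bootstrap hypothesis "grid average `> 1/2`" supplies such a `B` (`negLevyMoment_coherence_le`, companion file).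
References: Berg–Christensen–Ressel (1984) Ch. 3–4; Lieb–Seiringer–Solovej–Yngvason (2005) §1.2; Stringari (1995) §2.
-/

noncomputable section

namespace Summit.AtomisticToContinuum.BoseEinsteinCondensation.Theorems

open Finset MeasureTheory InfDivGlue
open Literature.MathematicalPhysics.QuantumManyBody.BoseGas
open scoped ENNReal ComplexConjugate

/-- **Grid average of the coherence from three Lévy moments** (single-state glue of route
`BECInfDivCoherence` with the crux weakened to a `λ`-weighted negative-mass bound). For a periodic trial
state `Ψ`, a particle `i` with `Σ_a ∫_{cell^N}|∂_{i,a}Ψ|² ≤ T`, a grid `m ≥ 2` with `(L/m)²T ≤ 1`, coherence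
`G > 0` at the nodes, and the discrete Lévy weights `ν_q = m⁻³ Σ_j log G(hj) cos(2π q·j/m)`: if
`Σ_{q≠0} ν_q⁻ Σ_a(1 − cos(2πq_a/m)) ≤ B` and `Σ_{q≠0} ν_q⁺/|k_q| ≤ C` (`|k_q| = (2π/L)|q̄|`), then for every
`s > 0`, `exp(−(π² (T + B/(L/m)²)/(6 s²) + 2 s C/3)) ≤ m⁻³ Σ_j G(hj)`.
[BergChristensenRessel1984 Ch. 3–4; LiebSeiringerSolovejYngvason2005 §1.2] -/
theorem gridAverage_exp_lower_bound :
    ∀ (N : ℕ) (L : ℝ), 0 < L → ∀ (m : ℕ) [NeZero m], 2 ≤ m →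
    ∀ (Ψ : PeriodicTrialState N L) (i : Fin N) (G : EuclideanSpace ℝ (Fin 3) → ℝ),
    (∀ r, G r = (∫ X in cellN N L, conj (Ψ.ψ (Function.update X i (X i + r))) * Ψ.ψ X).re) →
    ∀ (T B C s : ℝ), 0 < s → 0 ≤ T → (L / m) ^ 2 * T ≤ 1 →
    (∑ a : Fin 3, ∫⁻ X in cellN N L,
      (‖fderiv ℝ Ψ.ψ X (Pi.single i (EuclideanSpace.single a (1 : ℝ)))‖₊ : ℝ≥0∞) ^ 2) ≤
        ENNReal.ofReal T →
    (∀ j : Fin 3 → Fin m, 0 < G (latticeVec (L / m) fun k => ((j k : ℕ) : ℤ))) →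
    (∑ q : Fin 3 → Fin m with (∃ k, (q k : ℕ) ≠ 0),
      max (-((∑ j : Fin 3 → Fin m, Real.log (G (latticeVec (L / m) fun k => ((j k : ℕ) : ℤ))) *
          Real.cos (2 * Real.pi * (∑ k, ((q k : ℕ) : ℝ) * ((j k : ℕ) : ℝ)) / m)) / (m : ℝ) ^ 3)) 0 *
        (∑ a, (1 - Real.cos (2 * Real.pi * ((q a : ℕ) : ℝ) / m)))) ≤ B →
    (∑ q : Fin 3 → Fin m with (∃ k, (q k : ℕ) ≠ 0),
      max ((∑ j : Fin 3 → Fin m, Real.log (G (latticeVec (L / m) fun k => ((j k : ℕ) : ℤ))) *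
          Real.cos (2 * Real.pi * (∑ k, ((q k : ℕ) : ℝ) * ((j k : ℕ) : ℝ)) / m)) / (m : ℝ) ^ 3) 0 /
        (2 * Real.pi / L * Real.sqrt (∑ k, ((min (q k : ℕ) (m - (q k : ℕ)) : ℕ) : ℝ) ^ 2))) ≤ C →
    Real.exp (-(Real.pi ^ 2 * (T + B / (L / m) ^ 2) / (6 * s ^ 2) + 2 * s * C / 3)) ≤
      (∑ j : Fin 3 → Fin m, G (latticeVec (L / m) fun k => ((j k : ℕ) : ℤ))) / (m : ℝ) ^ 3 := by
  intro N L hL m _ hm Ψ i G hGdef T B C s hs hT hsmall hkin hGpos hB hC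
  have hm0 : 0 < m := by omega
  have hmpos : (0 : ℝ) < m := by exact_mod_cast hm0
  have hm3 : (0 : ℝ) < (m : ℝ) ^ 3 := by positivity
  have hhpos : 0 < L / m := div_pos hL hmpos
  have hhm : L / m * m = L := div_mul_cancel₀ _ hmpos.ne'
  -- kinetic slices
  have hτfin : ∀ a : Fin 3, (∫⁻ X in cellN N L,
      (‖fderiv ℝ Ψ.ψ X (Pi.single i (EuclideanSpace.single a (1 : ℝ)))‖₊ : ℝ≥0∞) ^ 2) ≠ ⊤ := fun a =>
    ne_top_of_le_ne_top ENNReal.ofReal_ne_top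
      ((Finset.single_le_sum (f := fun a : Fin 3 => ∫⁻ X in cellN N L,
        (‖fderiv ℝ Ψ.ψ X (Pi.single i (EuclideanSpace.single a (1 : ℝ)))‖₊ : ℝ≥0∞) ^ 2)
        (fun _ _ => zero_le) (Finset.mem_univ a)).trans hkin)
  have hτsum : ∑ a : Fin 3, (∫⁻ X in cellN N L,
      (‖fderiv ℝ Ψ.ψ X (Pi.single i (EuclideanSpace.single a (1 : ℝ)))‖₊ : ℝ≥0∞) ^ 2).toReal ≤ T := by
    rw [← ENNReal.toReal_sum fun a _ => hτfin a]
    exact ENNReal.toReal_le_of_le_ofReal hT hkin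
  have hτ0 : ∀ a : Fin 3, 0 ≤ (∫⁻ X in cellN N L,
      (‖fderiv ℝ Ψ.ψ X (Pi.single i (EuclideanSpace.single a (1 : ℝ)))‖₊ : ℝ≥0∞) ^ 2).toReal :=
    fun a => ENNReal.toReal_nonneg
  have hτle : ∀ a : Fin 3, (∫⁻ X in cellN N L,
      (‖fderiv ℝ Ψ.ψ X (Pi.single i (EuclideanSpace.single a (1 : ℝ)))‖₊ : ℝ≥0∞) ^ 2).toReal ≤ T :=
    fun a => (Finset.single_le_sum (f := fun a : Fin 3 => (∫⁻ X in cellN N L,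
      (‖fderiv ℝ Ψ.ψ X (Pi.single i (EuclideanSpace.single a (1 : ℝ)))‖₊ : ℝ≥0∞) ^ 2).toReal)
      (fun a _ => hτ0 a) (Finset.mem_univ a)).trans hτsum
  -- basic facts on `G`
  have hG0 : G 0 = 1 := by rw [hGdef]; exact coh_zero Ψ i
  have hGle : ∀ r, G r ≤ 1 := fun r => by rw [hGdef]; exact coh_le_one hL Ψ i r
  have hGper : ∀ (r : EuclideanSpace ℝ (Fin 3)) (k : Fin 3), G (r + EuclideanSpace.single k L) = G r := by
    intro r k; rw [hGdef, hGdef]; exact coh_add_single Ψ i r k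
  have hGtrans : ∀ (a : Fin 3) (t : ℝ), 1 - G (t • EuclideanSpace.single a 1) ≤ t ^ 2 / 2 * (∫⁻ X in cellN N L,
      (‖fderiv ℝ Ψ.ψ X (Pi.single i (EuclideanSpace.single a (1 : ℝ)))‖₊ : ℝ≥0∞) ^ 2).toReal := by
    intro a t; rw [hGdef]; exact one_sub_coh_le hL Ψ i a t (hτfin a)
  -- notation for the Lévy weights
  set F : (Fin 3 → Fin m) → ℝ := fun j =>
    Real.log (G (latticeVec (L / m) fun k => ((j k : ℕ) : ℤ))) with hFdef
  set ν : (Fin 3 → Fin m) → ℝ := fun q =>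
    (∑ j : Fin 3 → Fin m, F j *
      Real.cos (2 * Real.pi * (∑ k, ((q k : ℕ) : ℝ) * ((j k : ℕ) : ℝ)) / m)) / (m : ℝ) ^ 3 with hνdef
  set lam : (Fin 3 → Fin m) → ℝ := fun q => ∑ a, (1 - Real.cos (2 * Real.pi * ((q a : ℕ) : ℝ) / m))
    with hlam
  set kq : (Fin 3 → Fin m) → ℝ := fun q =>
    2 * Real.pi / L * Real.sqrt (∑ k, ((min (q k : ℕ) (m - (q k : ℕ)) : ℕ) : ℝ) ^ 2) with hkq
  set P := Finset.univ.filter fun q : Fin 3 → Fin m => ∃ k, (q k : ℕ) ≠ 0 with hP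
  have hC' : ∑ q ∈ P, max (ν q) 0 / kq q ≤ C := hC
  have hB' : ∑ q ∈ P, max (-ν q) 0 * lam q ≤ B := hB
  have hB0 : 0 ≤ B := hB'.trans' (Finset.sum_nonneg fun q _ => mul_nonneg (le_max_right _ _) (fsumWeight_nonneg q))
  have hlam0 : ∀ q, 0 ≤ lam q := fun q => fsumWeight_nonneg q
  have hlam_zero : lam 0 = 0 := by simp [hlam]
  -- values of `F` at `0` and `±e_a`
  have hF0 : F 0 = 0 := by
    have hz : (fun k => (((0 : Fin 3 → Fin m) k : ℕ) : ℤ)) = 0 := by funext k; simp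
    simp only [hFdef]
    rw [hz, latticeVec_zero, hG0, Real.log_one]
  have hF1 : ∀ a : Fin 3, F (Pi.single a 1) = Real.log (G ((L / m) • EuclideanSpace.single a 1)) := by
    intro a
    show Real.log (G (latticeVec (L / m) fun k =>
      (((Pi.single a (1 : Fin m) : Fin 3 → Fin m) k : ℕ) : ℤ))) = _
    rw [latticeVec_single_one hm (L / m) a]
  have hF2 : ∀ a : Fin 3, F (Pi.single a (-1)) = Real.log (G ((-(L / m)) • EuclideanSpace.single a 1)) := by
    intro a
    show Real.log (G (latticeVec (L / m) fun k =>
      (((Pi.single a (-1 : Fin m) : Fin 3 → Fin m) k : ℕ) : ℤ))) = _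
    rw [latticeVec_single_neg_one hm (L / m) a, hhm, hGper]
  -- make the abbreviations opaque (no zeta-unfolding in `linarith`/`simp` below)
  clear_value F ν lam kq P
  -- `-log G(±h e_a) ≤ h² τ_a`
  have neg_log_le : ∀ {x : ℝ}, 1 / 2 ≤ x → x ≤ 1 → -Real.log x ≤ 2 * (1 - x) := by
    intro x hx hx1
    have hx0 : 0 < x := by linarith
    have h1 := Real.one_sub_inv_le_log_of_pos hx0
    have h2 : x⁻¹ - 1 ≤ 2 * (1 - x) := by
      rw [inv_eq_one_div, div_sub_one hx0.ne', div_le_iff₀ hx0]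
      nlinarith
    linarith
  have hlog : ∀ (a : Fin 3) (t : ℝ), t ^ 2 = (L / m) ^ 2 →
      -Real.log (G (t • EuclideanSpace.single a 1)) ≤ (L / m) ^ 2 * (∫⁻ X in cellN N L,
      (‖fderiv ℝ Ψ.ψ X (Pi.single i (EuclideanSpace.single a (1 : ℝ)))‖₊ : ℝ≥0∞) ^ 2).toReal := by
    intro a t ht
    have h1' := hGtrans a t
    rw [ht] at h1'
    have hGhalf : 1 / 2 ≤ G (t • EuclideanSpace.single a 1) := by
      have : (L / m) ^ 2 / 2 * (∫⁻ X in cellN N L,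
          (‖fderiv ℝ Ψ.ψ X (Pi.single i (EuclideanSpace.single a (1 : ℝ)))‖₊ : ℝ≥0∞) ^ 2).toReal ≤
          (L / m) ^ 2 / 2 * T :=
        mul_le_mul_of_nonneg_left (hτle a) (by positivity)
      linarith
    have h2' := neg_log_le hGhalf (hGle _)
    linarith
  -- the discrete f-sum `Σ_q ν_q λ_q ≤ h² T`
  have hA : ∑ q, ν q * lam q ≤ (L / m) ^ 2 * T := by
    have hfs : ∑ q, ν q * lam q = 3 * F 0 - ∑ a : Fin 3, (F (Pi.single a 1) + F (Pi.single a (-1))) / 2 := by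
      rw [hνdef, hlam]; exact levyWeight_fsum hm F
    rw [hfs, hF0, mul_zero, zero_sub, neg_le]
    have hterm : ∀ a : Fin 3, -((F (Pi.single a 1) + F (Pi.single a (-1))) / 2) ≤ (L / m) ^ 2 *
        (∫⁻ X in cellN N L,
          (‖fderiv ℝ Ψ.ψ X (Pi.single i (EuclideanSpace.single a (1 : ℝ)))‖₊ : ℝ≥0∞) ^ 2).toReal := by
      intro a
      rw [hF1, hF2]
      have h1' := hlog a (L / m) rfl
      have h2' := hlog a (-(L / m)) (by ring)
      linarith
    calc -((L / m) ^ 2 * T) ≤ -((L / m) ^ 2 * ∑ a : Fin 3, (∫⁻ X in cellN N L,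
          (‖fderiv ℝ Ψ.ψ X (Pi.single i (EuclideanSpace.single a (1 : ℝ)))‖₊ : ℝ≥0∞) ^ 2).toReal) := by
          have := mul_le_mul_of_nonneg_left hτsum (sq_nonneg (L / m)); linarith
      _ = ∑ a : Fin 3, -((L / m) ^ 2 * (∫⁻ X in cellN N L,
          (‖fderiv ℝ Ψ.ψ X (Pi.single i (EuclideanSpace.single a (1 : ℝ)))‖₊ : ℝ≥0∞) ^ 2).toReal) := by
          rw [Finset.mul_sum, Finset.sum_neg_distrib]
      _ ≤ ∑ a : Fin 3, (F (Pi.single a 1) + F (Pi.single a (-1))) / 2 :=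
          Finset.sum_le_sum fun a _ => by linarith [hterm a]
  -- positive mass against `λ`: `Σ_{q≠0} ν⁺ λ ≤ h² T (1 + K/2)`
  have hsumP : ∑ q ∈ P, ν q * lam q = ∑ q, ν q * lam q := by
    rw [hP, Finset.sum_filter]
    refine Finset.sum_congr rfl fun q _ => ?_
    split_ifs with hq
    · rfl
    · push Not at hq
      have : q = 0 := funext fun k => Fin.ext (hq k)
      rw [this, hlam_zero, mul_zero]
  have hpos_lam : ∑ q ∈ P, max (ν q) 0 * lam q ≤ (L / m) ^ 2 * T + B := by
    have hpt : ∀ q, max (ν q) 0 * lam q = ν q * lam q + max (-ν q) 0 * lam q := by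
      intro q
      rw [← add_mul]
      congr 1
      rcases le_total 0 (ν q) with hq | hq
      · rw [max_eq_left hq, max_eq_right (by linarith)]; ring
      · rw [max_eq_right hq, max_eq_left (by linarith)]; ring
    rw [Finset.sum_congr rfl fun q _ => hpt q, Finset.sum_add_distrib, hsumP]
    exact add_le_add hA hB'
  -- Jordan and the elementary splitting `ν⁺ ≤ (π²/(6 s² h²)) ν⁺ λ + (2s/3) ν⁺/|k|`
  have hkpos : ∀ q ∈ P, 0 < kq q := by
    intro q hq
    rw [hP, Finset.mem_filter] at hq
    have h1 := one_le_sum_centred_sq hq.2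
    simp only [hkq]
    exact mul_pos (by positivity) (Real.sqrt_pos.2 (by linarith))
  have hJordan : ∀ q ∈ P, kq q ^ 2 ≤ Real.pi ^ 2 / (2 * (L / m) ^ 2) * lam q := by
    intro q _
    have hJ : 8 / (m : ℝ) ^ 2 * ∑ a, ((min (q a : ℕ) (m - (q a : ℕ)) : ℕ) : ℝ) ^ 2 ≤ lam q := by
      rw [hlam]; exact jordan_grid q
    have hS0 : 0 ≤ ∑ k, ((min (q k : ℕ) (m - (q k : ℕ)) : ℕ) : ℝ) ^ 2 :=
      Finset.sum_nonneg fun _ _ => sq_nonneg _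
    have hKsq : kq q ^ 2 = (2 * Real.pi / L) ^ 2 * ∑ k, ((min (q k : ℕ) (m - (q k : ℕ)) : ℕ) : ℝ) ^ 2 := by
      simp only [hkq]; rw [mul_pow, Real.sq_sqrt hS0]
    rw [hKsq]
    have hre : Real.pi ^ 2 / (2 * (L / m) ^ 2) * (8 / (m : ℝ) ^ 2 *
        ∑ a, ((min (q a : ℕ) (m - (q a : ℕ)) : ℕ) : ℝ) ^ 2) =
        (2 * Real.pi / L) ^ 2 * ∑ k, ((min (q k : ℕ) (m - (q k : ℕ)) : ℕ) : ℝ) ^ 2 := by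
      field_simp
      ring
    rw [← hre]
    exact mul_le_mul_of_nonneg_left hJ (by positivity)
  have hsplit : ∀ q ∈ P, max (ν q) 0 ≤
      Real.pi ^ 2 / (6 * s ^ 2 * (L / m) ^ 2) * (max (ν q) 0 * lam q) + 2 * s / 3 * (max (ν q) 0 / kq q) := by
    intro q hq
    have hk := hkpos q hq
    have hν0 : 0 ≤ max (ν q) 0 := le_max_right _ _
    -- `1 ≤ t²/3 + 2/(3t)` for `t = |k|/s`, i.e. `(t-1)²(t+2) ≥ 0`
    have hel : 1 ≤ (kq q / s) ^ 2 / 3 + 2 / 3 * (s / kq q) := by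
      have ht0 : 0 < kq q / s := div_pos hk hs
      have hst : s / kq q = 1 / (kq q / s) := by rw [one_div, inv_div]
      rw [hst, ← sub_nonneg]
      have : (kq q / s) ^ 2 / 3 + 2 / 3 * (1 / (kq q / s)) - 1 =
          (kq q / s - 1) ^ 2 * (kq q / s + 2) / (3 * (kq q / s)) := by
        field_simp; ring
      rw [this]
      positivity
    calc max (ν q) 0 = max (ν q) 0 * 1 := (mul_one _).symm
      _ ≤ max (ν q) 0 * ((kq q / s) ^ 2 / 3 + 2 / 3 * (s / kq q)) :=
          mul_le_mul_of_nonneg_left hel hν0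
      _ = 1 / (3 * s ^ 2) * (max (ν q) 0 * kq q ^ 2) + 2 * s / 3 * (max (ν q) 0 / kq q) := by
          field_simp
      _ ≤ 1 / (3 * s ^ 2) * (max (ν q) 0 * (Real.pi ^ 2 / (2 * (L / m) ^ 2) * lam q)) +
          2 * s / 3 * (max (ν q) 0 / kq q) := by
          gcongr
          exact hJordan q hq
      _ = Real.pi ^ 2 / (6 * s ^ 2 * (L / m) ^ 2) * (max (ν q) 0 * lam q) +
          2 * s / 3 * (max (ν q) 0 / kq q) := by
          field_simp
          ring
  -- the positive Lévy mass
  have hmass : ∑ q ∈ P, max (ν q) 0 ≤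
      Real.pi ^ 2 * (T + B / (L / m) ^ 2) / (6 * s ^ 2) + 2 * s * C / 3 := by
    calc ∑ q ∈ P, max (ν q) 0
        ≤ ∑ q ∈ P, (Real.pi ^ 2 / (6 * s ^ 2 * (L / m) ^ 2) * (max (ν q) 0 * lam q) +
            2 * s / 3 * (max (ν q) 0 / kq q)) := Finset.sum_le_sum hsplit
      _ = Real.pi ^ 2 / (6 * s ^ 2 * (L / m) ^ 2) * ∑ q ∈ P, max (ν q) 0 * lam q +
            2 * s / 3 * ∑ q ∈ P, max (ν q) 0 / kq q := by
          rw [Finset.sum_add_distrib, Finset.mul_sum, Finset.mul_sum]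
      _ ≤ Real.pi ^ 2 / (6 * s ^ 2 * (L / m) ^ 2) * ((L / m) ^ 2 * T + B) + 2 * s / 3 * C :=
          add_le_add (mul_le_mul_of_nonneg_left hpos_lam (by positivity))
            (mul_le_mul_of_nonneg_left hC' (by positivity))
      _ = Real.pi ^ 2 * (T + B / (L / m) ^ 2) / (6 * s ^ 2) + 2 * s * C / 3 := by
          field_simp
  -- `ν 0 = -Σ_{q≠0} ν_q ≥ -mass`, and AM–GM
  have hsumν : ∑ q, ν q = F 0 := by rw [hνdef]; exact sum_levyWeight F
  have hν0 : -(Real.pi ^ 2 * (T + B / (L / m) ^ 2) / (6 * s ^ 2) + 2 * s * C / 3) ≤ ν 0 := by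
    have hsplit0 := sum_eq_zero_add_sum_filter ν
    rw [hsumν, hF0] at hsplit0
    have hle : (∑ q ∈ P, ν q) ≤ ∑ q ∈ P, max (ν q) 0 := Finset.sum_le_sum fun q _ => le_max_left _ _
    have hP' : (∑ q : Fin 3 → Fin m with (∃ k, (q k : ℕ) ≠ 0), ν q) = ∑ q ∈ P, ν q := by rw [hP]
    rw [hP'] at hsplit0
    linarith only [hmass, hle, hsplit0]
  have hmean : ν 0 = (∑ j : Fin 3 → Fin m, F j) / (m : ℝ) ^ 3 := by
    simp only [hνdef]
    congr 1
    exact Finset.sum_congr rfl fun j _ => by simp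
  have hJ := exp_mean_log_le_mean (fun j : Fin 3 → Fin m => G (latticeVec (L / m) fun k => ((j k : ℕ) : ℤ)))
    (fun j => hGpos j)
  have hcard : (Fintype.card (Fin 3 → Fin m) : ℝ) = (m : ℝ) ^ 3 := by
    rw [Fintype.card_fun, Fintype.card_fin, Fintype.card_fin, Nat.cast_pow]
  rw [hcard] at hJ
  have hmean' : (∑ j : Fin 3 → Fin m, Real.log (G (latticeVec (L / m) fun k => ((j k : ℕ) : ℤ)))) /
      (m : ℝ) ^ 3 = ν 0 := by rw [hmean, hFdef]
  rw [hmean'] at hJ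
  exact (Real.exp_le_exp.2 hν0).trans hJ

end Summit.AtomisticToContinuum.BoseEinsteinCondensation.Theorems

end
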